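import Literature.Topology.FourManifolds.HomotopySpheresSignatureKilling
import Literature.AlgebraicTopology.SingularHomology.BoundaryClassGenerator
import HarnessLib

/-!
# A compact simply connected manifold with connected non-empty boundary and no homology below
# the top two degrees is contractible

Topic `Literature/Topology/FourManifolds` (fact seat
`provefact-Literature.Topology.FourManifolds.Matvey-69322e0896`, rung (H4)
`Literature.Topology.FourManifolds.Matveyev1996_partOne_and_fact_of_dualSpheres` of
`CorkDecompositionMiddleLevel.lean`).  Matveyev 1996 (arXiv:dg-ga/9505001), step 3: *"Surgery
of `V₃` […] gives two contractible sub-manifolds `W₁` and `W₂`"*; Kirby 1996 (arXiv:math/9712231),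
§3: the corks are contractible because they are simply connected with `H₂ = 0`.  The implicit
recognition step — **a compact simply connected 4-manifold with connected non-empty boundary
and `H₂ = 0` is contractible** — is the argument the tree already runs for null-cobordisms of
homotopy spheres (`NullCobordism.contractibleSpace_of_isZero_singularHomology_le`,
`HomotopySpheresSignatureKilling.lean`, after Kervaire–Milnor 1963, p. 514 / Thm. 6.6): the
homology above the hypothesis range is killed by Lefschetz duality
(`bijective_relCapProduct_of_isRelFundamentalClass_holds`, Hatcher Thm. 3.43) and universal
coefficients; in the degree of the boundary, `H_{m+1}(∂W) ≅ ℤ` is generated by the fundamental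
class of the boundary orientation `∂z` of a relative fundamental class `z` (Spanier Cor. 6.3.10,
`boundaryOrientation_fundamentalClass_eq`), which dies in `W`; above, `W ≃ W ∪ collar` is a
connected non-compact manifold (Hatcher Prop. 3.29); then Hurewicz, CW type and Whitehead
(Bredon VII Cor. 10.11).  Here the boundary is any connected closed manifold instead of a homotopy
sphere.  Everything here is proved; no definitions, no named facts:

* **`contractibleSpace_of_isZero_singularHomology_of_boundary_connected`** (namespace
  `Literature.Topology.FourManifolds`) — `W : Type` compact, simply connected, of dimension
  `m + 2` (`m ≥ 1`) with connected non-empty boundary and `H_q(W; ℤ) = 0` for `1 ≤ q ≤ m` is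
  contractible.

## References

* R. Matveyev, *A decomposition of smooth simply-connected h-cobordant 4-manifolds*,
  arXiv:dg-ga/9505001, Proof of Theorem, step 3. [Matveyev1996]
* R. Kirby, *Akbulut's corks and h-cobordisms of smooth, simply connected 4-manifolds*,
  arXiv:math/9712231, §3. [KirbyCorks1996]
* M. Kervaire, J. Milnor, *Groups of homotopy spheres I*, Ann. of Math. 77 (1963), p. 514 and
  Thm. 6.6 (p. 526). [KervaireMilnorAnnals1963]
* A. Hatcher, *Algebraic Topology*, CUP 2002, Thm. 3.26, Prop. 3.29, Thm. 3.43, §3.3 p. 253,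
  Thm. 4.5, Thm. 4.32, Cor. A.12. [HatcherAT2002]
* G. E. Bredon, *Topology and Geometry*, GTM 139 (1993), VII Cor. 10.11. [Bredon1993]
* E. Spanier, *Algebraic Topology* (1981), Ch. 6 §3 Cor. 10. [Spanier1981]
-/

noncomputable section

open scoped Manifold ContDiff Topology
open Set Function CategoryTheory CategoryTheory.Limits
open Literature.AlgebraicTopology.SingularHomology Literature.AlgebraicTopology.Homotopy

namespace Literature.Topology.FourManifolds

/-- **A compact simply connected `(m+2)`-manifold with connected non-empty boundary and
`H_q = 0` for `1 ≤ q ≤ m` (`m ≥ 1`) is contractible** (for `m = 2`: a compact simply connected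
    4-manifold
with connected non-empty boundary and `H₂ = 0`; Kervaire–Milnor 1963, p. 514 / Thm. 6.6 last
clause, Kosinski X p. 205, as run in the tree for null-cobordisms of homotopy spheres).
Proof: `Hᵖ(W; ℤ) = 0` for `1 ≤ p ≤ m` (universal coefficients), so Lefschetz duality gives
`H_q(W, ∂W) = 0` for `2 ≤ q ≤ m + 1`; in degree `m + 1` the sequence of the pair reads
`H_{m+1}(∂W) → H_{m+1}(W) → H_{m+1}(W, ∂W) = 0` and `H_{m+1}(∂W) ≅ ℤ` (connected closed
`ℤ`-oriented boundary, oriented by the boundary `∂z` of a relative fundamental class `z`,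
Spanier Cor. 6.3.10) is generated by `∂z ↦ 0`; in degrees `≥ m + 2`, `W ≃ W ∪ collar` is a
connected non-compact `(m+2)`-manifold (Hatcher Prop. 3.29); hence `H̃_*(W; ℤ) = 0`, all
homotopy groups vanish (Hurewicz) and `W`, of CW type, is contractible (Whitehead).
[cite: KervaireMilnorAnnals1963, Thm. 6.6 (p. 526, last clause) and p. 514]
[cite: HatcherAT2002, Thm. 3.26, Prop. 3.29, Thm. 3.43, Thm. 4.5, Thm. 4.32, Cor. A.12]
[cite: Spanier1981, Ch. 6 Sec. 3 Cor. 10] [cite: Bredon1993, Ch. VII Cor. 10.11] -/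
theorem contractibleSpace_of_isZero_singularHomology_of_boundary_connected {m : ℕ} (hm : 1 ≤ m)
    (W : Type)
    [TopologicalSpace W] [T2Space W] [SecondCountableTopology W] [CompactSpace W]
    [ChartedSpace (EuclideanHalfSpace (m + 1 + 1)) W] [IsManifold (𝓡∂ (m + 1 + 1)) ∞ W]
    [SimplyConnectedSpace W]
    (hne : ((𝓡∂ (m + 1 + 1)).boundary W).Nonempty)
    (hconn : IsConnected ((𝓡∂ (m + 1 + 1)).boundary W))
    (hH : ∀ q : ℕ, 1 ≤ q → q ≤ m → IsZero (singularHomology ℤ ℤ W q)) :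
    ContractibleSpace W := by
  -- the boundary as a closed connected topological `(m+1)`-manifold
  letI := boundaryTopChartedSpace (n := m + 1) (W := W)
  haveI : CompactSpace ↥((𝓡∂ (m + 1 + 1)).boundary W) :=
    isCompact_iff_compactSpace.1 isCompact_boundary
  haveI : ConnectedSpace ↥((𝓡∂ (m + 1 + 1)).boundary W) :=
    isConnected_iff_connectedSpace.1 hconn
  obtain ⟨x₀, hx₀⟩ := hne
  -- (2) a relative fundamental class and the boundary orientation `μ` with `[∂W]_μ = ∂z`
  obtain ⟨z, hz⟩ := exists_isRelFundamentalClass_of_simplyConnectedSpace (m + 1) W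
  let μ : HomologicalOrientation ℤ ↥((𝓡∂ (m + 1 + 1)).boundary W) (m + 1) :=
    boundaryOrientation ℤ (Nat.succ_ne_zero m) hz
  have hδz : μ.fundamentalClass =
      relativeSingularHomology.δ ℤ ℤ W ((𝓡∂ (m + 1 + 1)).boundary W) (m + 1) z :=
    boundaryOrientation_fundamentalClass_eq ℤ (Nat.succ_ne_zero m) hz
  -- (3) `Hᵖ(W; ℤ) = 0` for `1 ≤ p ≤ m` (universal coefficients)
  have hcoh : ∀ p : ℕ, 1 ≤ p → p ≤ m → IsZero (singularCohomology ℤ ℤ W p) := by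
    intro p hp hpm
    obtain ⟨p', rfl⟩ : ∃ p', p = p' + 1 := ⟨p - 1, by omega⟩
    have hbij : Bijective (kroneckerPairing ℤ ℤ W (p' + 1)) := by
      rcases Nat.eq_zero_or_pos p' with rfl | hpos
      · haveI : Module.Free ℤ (singularHomology ℤ ℤ W 0) := free_singularHomology_zero
        exact kroneckerPairing_bijective_of_free ℤ W 0
      · exact kroneckerPairing_bijective_of_isZero ℤ W p' (hH p' hpos (by omega))
    haveI : Subsingleton (singularHomology ℤ ℤ W (p' + 1)) :=
      ModuleCat.subsingleton_of_isZero (hH (p' + 1) (by omega) hpm)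
    haveI : Subsingleton (singularCohomology ℤ ℤ W (p' + 1)) := hbij.1.subsingleton
    exact ModuleCat.isZero_of_subsingleton _
  -- (4) Lefschetz duality: `H_q(W, ∂W; ℤ) ≅ H^{m+2-q}(W; ℤ) = 0` for `2 ≤ q ≤ m + 1`
  have hrel : ∀ q : ℕ, 2 ≤ q → q ≤ m + 1 →
      IsZero (relativeSingularHomology ℤ ℤ W ((𝓡∂ (m + 1 + 1)).boundary W) q) := by
    intro q h2 hq
    have hb := bijective_relCapProduct_of_isRelFundamentalClass_holds (R := ℤ) (m + 1) W z hz
      (p := m + 2 - q) (q := q) (by omega)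
    haveI : Subsingleton (singularCohomology ℤ ℤ W (m + 2 - q)) :=
      ModuleCat.subsingleton_of_isZero (hcoh _ (by omega) (by omega))
    haveI : Subsingleton (relativeSingularHomology ℤ ℤ W ((𝓡∂ (m + 1 + 1)).boundary W) q) :=
      hb.surjective.subsingleton
    exact ModuleCat.isZero_of_subsingleton _
  -- (6) degree `m + 1`: `H_{m+1}(∂W) ≅ ℤ` is generated by `[∂W]_μ = ∂z`, killed in `H_{m+1}(W)`
  have h0 : singularHomology.map ℤ ℤ
      (⟨Subtype.val, continuous_subtype_val⟩ : C(↥((𝓡∂ (m + 1 + 1)).boundary W), W)) (m + 1)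
      (relativeSingularHomology.δ ℤ ℤ W ((𝓡∂ (m + 1 + 1)).boundary W) (m + 1) z) = 0 := by
    rw [← ModuleCat.comp_apply, relativeSingularHomology.δ_comp_map]
    rfl
  have hi : singularHomology.map ℤ ℤ
      (⟨Subtype.val, continuous_subtype_val⟩ : C(↥((𝓡∂ (m + 1 + 1)).boundary W), W))
      (m + 1) = 0 := by
    -- `H_{m+1}(∂W) ≅ H_{m+1}(∂W | x₀) ≅ ℤ`, `[∂W]_μ ↦ 1` (Hatcher Thm. 3.26)
    haveI := singularHomology.isIso_toLocal_of_orientation μ ⟨x₀, hx₀⟩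
    obtain ⟨e, he⟩ := μ.isGenerator ⟨x₀, hx₀⟩
    have hfc : singularHomology.toLocal ℤ ℤ (⟨x₀, hx₀⟩ : ↥((𝓡∂ (m + 1 + 1)).boundary W)) (m + 1)
        μ.fundamentalClass = μ.localClass ⟨x₀, hx₀⟩ :=
      HomologicalOrientation.isFundamentalClass_fundamentalClass_holds (R := ℤ)
        (X := ↥((𝓡∂ (m + 1 + 1)).boundary W)) (m + 1) μ ⟨x₀, hx₀⟩
    let φ : singularHomology ℤ ℤ ↥((𝓡∂ (m + 1 + 1)).boundary W) (m + 1) ≃ₗ[ℤ] ℤ :=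
      (asIso (singularHomology.toLocal ℤ ℤ (⟨x₀, hx₀⟩ : ↥((𝓡∂ (m + 1 + 1)).boundary W))
        (m + 1))).toLinearEquiv.trans e
    have hφ : φ.symm 1 = μ.fundamentalClass := by
      rw [LinearEquiv.symm_apply_eq]
      change 1 = e ((asIso (singularHomology.toLocal ℤ ℤ
        (⟨x₀, hx₀⟩ : ↥((𝓡∂ (m + 1 + 1)).boundary W)) (m + 1))).hom μ.fundamentalClass)
      rw [asIso_hom, hfc, he]
    -- the map `H_{m+1}(∂W) → H_{m+1}(W)` vanishes on `[∂W]_μ = ∂z`, hence on `ℤ · [∂W]_μ`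
    have h1 : singularHomology.map ℤ ℤ
        (⟨Subtype.val, continuous_subtype_val⟩ : C(↥((𝓡∂ (m + 1 + 1)).boundary W), W))
        (m + 1) μ.fundamentalClass = 0 := by
      rw [hδz, h0]
    have key : (singularHomology.map ℤ ℤ
        (⟨Subtype.val, continuous_subtype_val⟩ : C(↥((𝓡∂ (m + 1 + 1)).boundary W), W))
        (m + 1)).hom ∘ₗ φ.symm.toLinearMap = 0 := by
      refine LinearMap.ext_ring ?_
      rw [LinearMap.zero_apply, LinearMap.comp_apply, LinearEquiv.coe_coe, hφ]
      exact h1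
    ext a
    have hka := LinearMap.congr_fun key (φ a)
    rw [LinearMap.comp_apply, LinearEquiv.coe_coe, LinearEquiv.symm_apply_apply,
      LinearMap.zero_apply] at hka
    rw [ModuleCat.hom_zero, LinearMap.zero_apply]
    exact hka
  have htop : IsZero (singularHomology ℤ ℤ W (m + 1)) :=
    (relativeSingularHomology.exact_map_ofAbsolute ℤ ℤ ((𝓡∂ (m + 1 + 1)).boundary W)
        (m + 1)).isZero_of_both_zeros hi ((hrel (m + 1) (by omega) le_rfl).eq_of_tgt _ _)
  -- (7) degrees `≥ m + 2`: `W ≃ W ∪ collar`, a connected non-compact `(m+2)`-manifold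
  have hhigh : ∀ q : ℕ, m + 1 + 1 ≤ q → IsZero (singularHomology ℤ ℤ W q) := by
    intro q hq
    haveI : SimplyConnectedSpace (ExtCollar (m + 1) W) :=
      (homotopyEquivExtCollar (m + 1) W).symm.simplyConnectedSpace
    haveI : NoncompactSpace (ExtCollar (m + 1) W) :=
      ExtCollar.noncompactSpace_of_nonempty_boundary ⟨x₀, hx₀⟩
    exact (clocalHomology.isZero_singularHomology_of_noncompact ℤ ℤ
      (X := ExtCollar (m + 1) W) (n := m + 1 + 1) hq).of_iso
      (singularHomology.isoOfHomotopyEquiv ℤ ℤ (homotopyEquivExtCollar (m + 1) W) q)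
  -- (8) `H̃_*(W; ℤ) = 0`; Hurewicz, CW type, Whitehead
  have hac : ∀ q : ℕ, 1 ≤ q → IsZero (singularHomology ℤ ℤ W q) := by
    intro q hq
    rcases lt_trichotomy q (m + 1) with h | rfl | h
    · exact hH q hq (by omega)
    · exact htop
    · exact hhigh q (by omega)
  have hπ := subsingleton_homotopyGroup_of_isZero_singularHomology_of_subsingleton
    hurewicz_subsingleton_holds hac
  obtain ⟨C, _, _, _, ⟨e⟩⟩ :=
    exists_cwComplex_homotopyEquiv_of_compactSpace_boundary_holds (m + 1) W
  haveI : SimplyConnectedSpace C := e.symm.simplyConnectedSpace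
  have hC : ∀ j : ℕ, 1 ≤ j → ∀ y : C, Subsingleton (π_ j C y) := fun j hj y =>
    subsingleton_homotopyGroup_of_homotopyEquiv e.symm (hπ j hj) y
  haveI : ContractibleSpace C := whitehead_contractibleSpace_holds C hC
  exact e.contractibleSpace

end Literature.Topology.FourManifolds

end
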